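import Summits.BirchSwinnertonDyer.Rank1Residual.X11b.FramePrincipalUnitPowers
import Mathlib.Data.Nat.Factorial.BigOperators
import HarnessLib

/-!
# X11b — SEPARATING POLYNOMIALS for the powers of a principal unit and their translate: if
# `b ∉ x^{ℤ}` up to distance `δ`, there are polynomials `≈ 0` on `{x^k}` and `≈ 1` on `{b·x^k}`

HONEST FRAMING (cell `b2b-bsdres`, run/shared/lean/b2b/bsd-rank1-residual/, verbatim in every
file): the goal of the cell is to DELETE the COMBINATION-SHAPED residual classes of the
Birch–Swinnerton-Dyer formula for ALL analytic-rank `≤ 1` elliptic curves over `ℚ` — "full BSD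
formula for every rank `≤ 1` curve in class `C`" assembled STRICTLY from published theorems — so
that the rank-`≤ 1` remainder becomes exactly the CONSTRUCTION-SHAPED classes, which are TYPED
(missing-input `Prop`s), NOT attempted. This is not "finishing BSD". Sub-cell
`b2b-bsdres-multr1-p1` (X11b, route R1, gen 25); THEOREMS ONLY (elementary `p`-adic analysis; no
definition, no named fact, no `sorry`); valid at every prime `p`; nothing here changes a label.

## Why this file (step II-b of IDEAL RIGIDITY ACROSS PERIODS, INTENT HOME/INBOX.md 2026-08-21)

For `x ∈ ℂ_p` with `‖x − 1‖ < p⁻¹` and `b ∈ ℂ_p` at distance `≥ δ > 0` from every integer power `x^n`: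
§1 the products `Π_k = ∏_{i<p^K} (b − x^{i−k})` — range-shift recursion (`R1.sepProd_succ_mul`),
`‖Π_k/Π_0 − 1‖ ≤ t₀ = ‖x − 1‖·p^{−K}/δ` (`R1.norm_sepProd_div_sub_one_le`), and
`∏_{i<p^K}(b·x^k − x^i) = x^{k p^K}·Π_k` (`R1.prod_mul_pow_sub_pow_eq`); §2
`‖∏_{i<p^K}(x^k − x^i)‖ ≤ ‖x − 1‖^{p^K}·‖(p^K)!‖_p` (`R1.norm_prod_pow_sub_pow_le`) while
`‖Π_0‖ ≥ δ·‖x − 1‖^{p^K−1}·‖(p^K − 1)!‖_p` (`R1.le_norm_sepProd_zero`, via the closest point and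
`∏_{i≠i*}(i − i*) = ±i*!·(p^K−1−i*)!`, `R1.prod_erase_sub_eq`); §3 **`R1.exists_separating_polynomial`**:
for every `ε > 0` a polynomial `G ∈ ℂ_p[X]` with `‖G(x^k)‖ ≤ ε` and `‖G(b·x^k) − 1‖ ≤ ε` for ALL
`k : ℕ` (`G = 1 − (1 − (P/Π_0)^N)^N`, `P = ∏_{i<p^K}(X − x^i)`, with the bump of step II-a).

References: [Washington1997] §5.1; [Serre1973] Ch. II §3 (principal units).
-/

noncomputable section

open scoped Classical Topology
open Filter Finset Polynomial
open Summit.BirchSwinnertonDyer.Rank1Residual.X11b.Three.LambdaSupply.PadicUnits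

namespace Summit.BirchSwinnertonDyer.Rank1Residual.X11b

variable {p : ℕ} [Fact p.Prime]

/-! ### §0 Small tools -/

/-- A principal unit `x` (`‖x − 1‖ < 1`) is non-zero. [folklore] -/
theorem R1.ne_zero_of_norm_sub_one_lt {x : ℂ_[p]} (hx : ‖x - 1‖ < 1) : x ≠ 0 := by
  intro h; rw [h, zero_sub, norm_neg, norm_one] at hx; exact lt_irrefl _ hx
/-- Product of two elements of the ball `‖u − 1‖ ≤ t` (`t < 1`) is in it. [folklore] -/
theorem R1.norm_mul_sub_one_le {u v : ℂ_[p]} {t : ℝ} (ht : t < 1) (hu : ‖u - 1‖ ≤ t)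
    (hv : ‖v - 1‖ ≤ t) : ‖u * v - 1‖ ≤ t := by
  have hv1 : ‖v‖ = 1 := R1.norm_eq_one_of_norm_sub_one_lt (hv.trans_lt ht)
  have h : u * v - 1 = (u - 1) * v + (v - 1) := by ring
  rw [h]
  refine (IsUltrametricDist.norm_add_le_max _ _).trans (max_le ?_ hv)
  rw [norm_mul, hv1, mul_one]; exact hu

/-- `‖u/v − 1‖ ≤ ‖u − v‖/δ` when `‖v‖ ≥ δ > 0`. [folklore] -/
theorem R1.norm_div_sub_one_le {u v : ℂ_[p]} {δ : ℝ} (hδ0 : 0 < δ) (hv : δ ≤ ‖v‖) :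
    ‖u / v - 1‖ ≤ ‖u - v‖ / δ := by
  have hv0 : v ≠ 0 := norm_pos_iff.mp (hδ0.trans_le hv)
  have h : u / v - 1 = (u - v) / v := by field_simp
  rw [h, norm_div]
  exact div_le_div_of_nonneg_left (norm_nonneg _) hδ0 hv

/-! ### §1 The products `Π_k` -/

section Products

variable {x b : ℂ_[p]} {δ : ℝ} {K : ℕ}

/-- Factors with exponents congruent mod `p^K` differ by a principal unit within `‖x − 1‖·p^{−K}/δ`.
[cite: Washington1997, §5.1] -/
theorem R1.norm_div_sub_one_le_of_dvd (hx : ‖x - 1‖ < (p : ℝ)⁻¹) (hδ0 : 0 < δ)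
    (hδ : ∀ n : ℤ, δ ≤ ‖b - x ^ n‖) {n n' : ℤ} (hK : (p ^ K : ℤ) ∣ n' - n) :
    ‖(b - x ^ n) / (b - x ^ n') - 1‖ ≤ ‖x - 1‖ * (p : ℝ) ^ (-(K : ℤ)) / δ := by
  refine (R1.norm_div_sub_one_le hδ0 (hδ n')).trans ?_
  refine div_le_div_of_nonneg_right ?_ hδ0.le
  have h : b - x ^ n - (b - x ^ n') = x ^ n' - x ^ n := by ring
  rw [h]
  exact R1.norm_zpow_sub_zpow_le_of_dvd hx hK

/-- Range-shift recursion for the products `∏_{i<M+1} (b − x^{i−k})`. [folklore] -/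
theorem R1.sepProd_succ_mul (x b : ℂ_[p]) (M k : ℕ) :
    (∏ i ∈ range (M + 1), (b - x ^ ((i : ℤ) - (k + 1 : ℕ)))) * (b - x ^ ((M : ℤ) - k)) =
      (b - x ^ (-1 - (k : ℤ))) * ∏ i ∈ range (M + 1), (b - x ^ ((i : ℤ) - k)) := by
  rw [prod_range_succ' (fun i => b - x ^ ((i : ℤ) - (k + 1 : ℕ))),
    prod_range_succ (fun i => b - x ^ ((i : ℤ) - k))]
  have h0 : ((0 : ℕ) : ℤ) - ((k + 1 : ℕ) : ℤ) = -1 - (k : ℤ) := by push_cast; ring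
  have h1 : ∀ i : ℕ, ((i + 1 : ℕ) : ℤ) - ((k + 1 : ℕ) : ℤ) = (i : ℤ) - k := by
    intro i; push_cast; ring
  simp_rw [h1, h0]
  ring

/-- **All `Π_k = ∏_{i<p^K}(b − x^{i−k})` agree with `Π_0` up to a principal unit within
`t₀ = ‖x − 1‖·p^{−K}/δ`** (`t₀ < 1`); induction on `k` with the range-shift recursion.
[cite: Washington1997, §5.1] -/
theorem R1.norm_sepProd_div_sub_one_le (hx : ‖x - 1‖ < (p : ℝ)⁻¹) (hδ0 : 0 < δ)
    (hδ : ∀ n : ℤ, δ ≤ ‖b - x ^ n‖) (ht : ‖x - 1‖ * (p : ℝ) ^ (-(K : ℤ)) / δ < 1) (k : ℕ) :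
    ‖(∏ i ∈ range (p ^ K), (b - x ^ ((i : ℤ) - k))) /
        (∏ i ∈ range (p ^ K), (b - x ^ ((i : ℤ) - (0 : ℕ)))) - 1‖ ≤
      ‖x - 1‖ * (p : ℝ) ^ (-(K : ℤ)) / δ := by
  have hp : p.Prime := Fact.out
  set t₀ := ‖x - 1‖ * (p : ℝ) ^ (-(K : ℤ)) / δ with ht₀
  have ht₀0 : 0 ≤ t₀ := by positivity
  have hne : ∀ n : ℤ, b - x ^ n ≠ 0 := fun n => norm_pos_iff.mp (hδ0.trans_le (hδ n))
  have hPne : ∀ k : ℕ, (∏ i ∈ range (p ^ K), (b - x ^ ((i : ℤ) - k))) ≠ 0 :=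
    fun k => prod_ne_zero_iff.mpr fun i _ => hne _
  obtain ⟨M, hM⟩ : ∃ M, p ^ K = M + 1 := ⟨p ^ K - 1, (Nat.succ_pred_eq_of_pos (pow_pos hp.pos K)).symm⟩
  induction k with
  | zero =>
    rw [div_self (hPne 0), sub_self, norm_zero]; exact ht₀0
  | succ k ih =>
    -- ratio of consecutive products
    have hrec := R1.sepProd_succ_mul x b M k
    rw [← hM] at hrec
    have hMk : (p ^ K : ℤ) ∣ ((M : ℤ) - k) - (-1 - (k : ℤ)) := by
      refine ⟨1, ?_⟩
      have : (M : ℤ) = (p : ℤ) ^ K - 1 := by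
        have := congrArg (fun n : ℕ => (n : ℤ)) hM; push_cast at this; linarith
      rw [this]; ring
    have hratio : ‖(b - x ^ (-1 - (k : ℤ))) / (b - x ^ ((M : ℤ) - k)) - 1‖ ≤ t₀ :=
      R1.norm_div_sub_one_le_of_dvd hx hδ0 hδ hMk
    -- `Π_{k+1}/Π_0 = (Π_k/Π_0) · ratio`
    have heq : (∏ i ∈ range (p ^ K), (b - x ^ ((i : ℤ) - (k + 1 : ℕ)))) /
        (∏ i ∈ range (p ^ K), (b - x ^ ((i : ℤ) - (0 : ℕ)))) =
        ((∏ i ∈ range (p ^ K), (b - x ^ ((i : ℤ) - k))) /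
          (∏ i ∈ range (p ^ K), (b - x ^ ((i : ℤ) - (0 : ℕ))))) *
        ((b - x ^ (-1 - (k : ℤ))) / (b - x ^ ((M : ℤ) - k))) := by
      have h1 : (∏ i ∈ range (p ^ K), (b - x ^ ((i : ℤ) - (k + 1 : ℕ)))) =
          (b - x ^ (-1 - (k : ℤ))) * (∏ i ∈ range (p ^ K), (b - x ^ ((i : ℤ) - k))) /
            (b - x ^ ((M : ℤ) - k)) := by
        rw [eq_div_iff (hne _), hrec]
      rw [h1]
      field_simp
    rw [heq]
    exact R1.norm_mul_sub_one_le ht ih hratio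

/-- `∏_{i<n}(b·x^k − x^i) = x^{k·n} · ∏_{i<n}(b − x^{i−k})`. [folklore] -/
theorem R1.prod_mul_pow_sub_pow_eq (hx0 : x ≠ 0) (b : ℂ_[p]) (n k : ℕ) :
    ∏ i ∈ range n, (b * x ^ k - x ^ i) = x ^ (k * n) * ∏ i ∈ range n, (b - x ^ ((i : ℤ) - k)) := by
  have hfac : ∀ i : ℕ, b * x ^ k - x ^ i = x ^ k * (b - x ^ ((i : ℤ) - k)) := by
    intro i
    rw [mul_sub, mul_comm (x ^ k) b]
    congr 1
    rw [← zpow_natCast x i, ← zpow_natCast x k, ← zpow_add₀ hx0, add_sub_cancel]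
  simp_rw [hfac]
  rw [prod_mul_distrib, prod_const, card_range, ← pow_mul]

end Products

/-! ### §2 The other side: `∏(x^k − x^i)` is small, `Π_0` is not -/

section Bounds

variable {x b : ℂ_[p]} {δ : ℝ} {K : ℕ}

/-- `‖∏_{i<n}(x^k − x^i)‖ ≤ ‖x − 1‖^{n}·‖n!‖_p` (`∏_{i<n}(k − i) = n!·C(k, n)`). [cite: Washington1997, §5.1] -/
theorem R1.norm_prod_pow_sub_pow_le (hx : ‖x - 1‖ < (p : ℝ)⁻¹) (n k : ℕ) :
    ‖∏ i ∈ range n, (x ^ k - x ^ i)‖ ≤ ‖x - 1‖ ^ n * ‖((n.factorial : ℕ) : ℚ_[p])‖ := by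
  have hp : p.Prime := Fact.out
  have hp1 : (p : ℝ)⁻¹ ≤ 1 := inv_le_one_of_one_le₀ (by exact_mod_cast hp.one_lt.le)
  have hx1 : ‖x - 1‖ < 1 := hx.trans_le hp1
  by_cases hk : k < n
  · rw [prod_eq_zero (mem_range.mpr hk) (sub_self _), norm_zero]; positivity
  · push Not at hk
    have hfac : ∀ i ∈ range n, ‖x ^ k - x ^ i‖ = ‖x - 1‖ * ‖((k - i : ℕ) : ℚ_[p])‖ := by
      intro i hi
      have hik : i ≤ k := (mem_range.mp hi).le.trans hk
      have hki : k - i ≠ 0 := Nat.sub_ne_zero_of_lt ((mem_range.mp hi).trans_le hk)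
      have h1 : x ^ k - x ^ i = x ^ i * (x ^ (k - i) - 1) := by
        rw [mul_sub, mul_one, ← pow_add, Nat.add_sub_cancel' hik]
      rw [h1, norm_mul, norm_pow, R1.norm_eq_one_of_norm_sub_one_lt hx1, one_pow, one_mul,
        R1.norm_pow_sub_one_eq hx hki]
    rw [norm_prod, prod_congr rfl hfac, prod_mul_distrib, prod_const, card_range, ← norm_prod,
      ← Nat.cast_prod, ← Nat.descFactorial_eq_prod_range, Nat.descFactorial_eq_factorial_mul_choose,
      Nat.cast_mul, norm_mul]
    refine mul_le_mul_of_nonneg_left ?_ (pow_nonneg (norm_nonneg _) _)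
    exact mul_le_of_le_one_right (norm_nonneg _) (by
      rw [← Int.cast_natCast]; exact Padic.norm_int_le_one _)

/-- `∏_{j<s} (−(j+1)) = (−1)^s · s!`. [folklore] -/
theorem R1.prod_range_neg_succ (s : ℕ) :
    ∏ j ∈ range s, (-((j : ℤ) + 1)) = (-1) ^ s * (s.factorial : ℤ) := by
  have h1 : ∏ j ∈ range s, (-((j : ℤ) + 1)) = ∏ j ∈ range s, ((-1 : ℤ) * ((j : ℤ) + 1)) :=
    prod_congr rfl fun j _ => by ring
  rw [h1, prod_mul_distrib, prod_const, card_range, Nat.factorial_eq_prod_range_add_one, Nat.cast_prod]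
  push_cast
  rfl

/-- **`∏_{i<n, i≠s} (i − s) = (−1)^{s}·s!·(n−1−s)!`** in `ℤ`, for `s < n`. [folklore] -/
theorem R1.prod_erase_sub_eq {n s : ℕ} (hs : s < n) :
    ∏ i ∈ (range n).erase s, ((i : ℤ) - s) =
      (-1) ^ s * ((s.factorial * (n - 1 - s).factorial : ℕ) : ℤ) := by
  obtain ⟨m, rfl⟩ : ∃ m, n = s + 1 + m := ⟨n - (s + 1), by omega⟩
  have hsplit : (range (s + 1 + m)).erase s = range s ∪ Ico (s + 1) (s + 1 + m) := by
    ext i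
    simp only [mem_erase, mem_range, mem_union, mem_Ico]
    omega
  have hdisj : Disjoint (range s) (Ico (s + 1) (s + 1 + m)) := by
    rw [disjoint_left]; intro i hi hi'
    simp only [mem_range] at hi; simp only [mem_Ico] at hi'; omega
  rw [hsplit, prod_union hdisj]
  have hleft : ∏ i ∈ range s, ((i : ℤ) - s) = (-1) ^ s * (s.factorial : ℤ) := by
    rw [← prod_range_reflect (fun i : ℕ => ((i : ℤ) - s)) s, ← R1.prod_range_neg_succ s]
    refine prod_congr rfl fun j hj => ?_
    have hj' := mem_range.mp hj
    have : ((s - 1 - j : ℕ) : ℤ) = (s : ℤ) - 1 - j := by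
      rw [Nat.sub_sub, Nat.cast_sub (by omega)]; push_cast; ring
    rw [this]; ring
  have hright : ∏ i ∈ Ico (s + 1) (s + 1 + m), ((i : ℤ) - s) = (m.factorial : ℤ) := by
    rw [prod_Ico_eq_prod_range, show s + 1 + m - (s + 1) = m by omega,
      Nat.factorial_eq_prod_range_add_one, Nat.cast_prod]
    refine prod_congr rfl fun j _ => ?_
    push_cast; ring
  rw [hleft, hright, show s + 1 + m - 1 - s = m by omega]
  push_cast; ring

/-- `‖(n−1)!‖_p ≤ ∏_{i<n, i≠s} ‖i − s‖_p` (`s < n`): `±s!(n−1−s)! ∣ (n−1)!`. [folklore] -/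
theorem R1.norm_factorial_le_prod_norm_sub {n s : ℕ} (hs : s < n) :
    ‖(((n - 1).factorial : ℕ) : ℚ_[p])‖ ≤ ∏ i ∈ (range n).erase s, ‖((i : ℤ) - s : ℚ_[p])‖ := by
  have hdvd : s.factorial * (n - 1 - s).factorial ∣ (n - 1).factorial :=
    Nat.factorial_mul_factorial_dvd_factorial (by omega)
  obtain ⟨c, hc⟩ := hdvd
  have hprod : ((∏ i ∈ (range n).erase s, ((i : ℤ) - s) : ℤ) : ℚ_[p]) =
      ∏ i ∈ (range n).erase s, ((i : ℤ) - s : ℚ_[p]) := by push_cast; rfl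
  have hc1 : ‖(c : ℚ_[p])‖ ≤ 1 := by rw [← Int.cast_natCast]; exact Padic.norm_int_le_one _
  rw [← norm_prod, ← hprod, R1.prod_erase_sub_eq hs, hc]
  push_cast
  simp only [norm_mul, norm_pow, norm_neg, norm_one, one_pow, one_mul]
  exact mul_le_of_le_one_right (by positivity) hc1

/-- **Lower bound**: `‖∏_{i<n}(b − x^i)‖ ≥ δ·‖x − 1‖^{n−1}·‖(n−1)!‖_p` (`n ≥ 1`) — through the
closest point `x^{i*}`: `‖b − x^i‖ ≥ ‖x^{i*} − x^i‖ = ‖x − 1‖·‖i − i*‖_p` for `i ≠ i*`.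
[cite: Washington1997, §5.1] -/
theorem R1.le_norm_sepProd_zero (hx : ‖x - 1‖ < (p : ℝ)⁻¹)
    (hδ : ∀ m : ℤ, δ ≤ ‖b - x ^ m‖) {n : ℕ} (hn : 0 < n) :
    δ * (‖x - 1‖ ^ (n - 1) * ‖(((n - 1).factorial : ℕ) : ℚ_[p])‖) ≤
      ‖∏ i ∈ range n, (b - x ^ ((i : ℤ) - (0 : ℕ)))‖ := by
  have hp : p.Prime := Fact.out
  have hp1 : (p : ℝ)⁻¹ ≤ 1 := inv_le_one_of_one_le₀ (by exact_mod_cast hp.one_lt.le)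
  have hx1 : ‖x - 1‖ < 1 := hx.trans_le hp1
  have hx0 : x ≠ 0 := R1.ne_zero_of_norm_sub_one_lt hx1
  simp only [Nat.cast_zero, sub_zero]
  obtain ⟨s, hs, hmin⟩ := exists_min_image (range n) (fun i : ℕ => ‖b - x ^ (i : ℤ)‖)
    ⟨0, mem_range.mpr hn⟩
  have hsn : s < n := mem_range.mp hs
  have hfac : ∀ i ∈ (range n).erase s, ‖x - 1‖ * ‖((i : ℤ) - s : ℚ_[p])‖ ≤ ‖b - x ^ (i : ℤ)‖ := by
    intro i hi
    have hi' : i ∈ range n := mem_of_mem_erase hi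
    have hge : ‖x ^ (s : ℤ) - x ^ (i : ℤ)‖ ≤ ‖b - x ^ (i : ℤ)‖ := by
      by_contra hlt
      push Not at hlt
      have h1 : x ^ (s : ℤ) - x ^ (i : ℤ) = (b - x ^ (i : ℤ)) - (b - x ^ (s : ℤ)) := by ring
      have h2 : ‖x ^ (s : ℤ) - x ^ (i : ℤ)‖ ≤ max ‖b - x ^ (i : ℤ)‖ ‖b - x ^ (s : ℤ)‖ := by
        rw [h1, sub_eq_add_neg, ← norm_neg (b - x ^ (s : ℤ))]
        exact IsUltrametricDist.norm_add_le_max _ _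
      have h3 : max ‖b - x ^ (i : ℤ)‖ ‖b - x ^ (s : ℤ)‖ = ‖b - x ^ (i : ℤ)‖ :=
        max_eq_left (hmin i hi')
      rw [h3] at h2
      exact absurd h2 (not_le.mpr hlt)
    refine le_trans ?_ hge
    -- `‖x^s − x^i‖ = ‖x − 1‖·‖i − s‖_p`
    rcases lt_or_gt_of_ne (ne_of_mem_erase hi) with his | his
    · -- `i < s`: `x^s − x^i = x^i (x^{s-i} − 1)`
      have h1 : x ^ (s : ℤ) - x ^ (i : ℤ) = x ^ i * (x ^ (s - i) - 1) := by
        rw [zpow_natCast, zpow_natCast, mul_sub, mul_one, ← pow_add, Nat.add_sub_cancel' his.le]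
      rw [h1, norm_mul, norm_pow, R1.norm_eq_one_of_norm_sub_one_lt hx1, one_pow, one_mul,
        R1.norm_pow_sub_one_eq hx (Nat.sub_ne_zero_of_lt his)]
      have hcast : ((i : ℤ) - s : ℚ_[p]) = -(((s - i : ℕ) : ℚ_[p])) := by
        push_cast [Nat.cast_sub his.le]; ring
      rw [hcast, norm_neg]
    · -- `s < i`
      have h1 : x ^ (s : ℤ) - x ^ (i : ℤ) = -(x ^ s * (x ^ (i - s) - 1)) := by
        rw [zpow_natCast, zpow_natCast, mul_sub, mul_one, ← pow_add, Nat.add_sub_cancel' his.le]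
        ring
      rw [h1, norm_neg, norm_mul, norm_pow, R1.norm_eq_one_of_norm_sub_one_lt hx1, one_pow,
        one_mul, R1.norm_pow_sub_one_eq hx (Nat.sub_ne_zero_of_lt his)]
      have hcast : ((i : ℤ) - s : ℚ_[p]) = ((i - s : ℕ) : ℚ_[p]) := by
        push_cast [Nat.cast_sub his.le]; ring
      rw [hcast]
  rw [← mul_prod_erase (range n) (fun i : ℕ => b - x ^ (i : ℤ)) hs, norm_mul, norm_prod]
  have hδs : δ ≤ ‖b - x ^ (s : ℤ)‖ := hδ s
  have hrest : ‖x - 1‖ ^ (n - 1) * ‖(((n - 1).factorial : ℕ) : ℚ_[p])‖ ≤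
      ∏ i ∈ (range n).erase s, ‖b - x ^ (i : ℤ)‖ := by
    calc ‖x - 1‖ ^ (n - 1) * ‖(((n - 1).factorial : ℕ) : ℚ_[p])‖
        ≤ ‖x - 1‖ ^ (n - 1) * ∏ i ∈ (range n).erase s, ‖((i : ℤ) - s : ℚ_[p])‖ :=
          mul_le_mul_of_nonneg_left (R1.norm_factorial_le_prod_norm_sub hsn) (by positivity)
      _ = ∏ i ∈ (range n).erase s, (‖x - 1‖ * ‖((i : ℤ) - s : ℚ_[p])‖) := by
          rw [prod_mul_distrib, prod_const, card_erase_of_mem hs, card_range]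
      _ ≤ ∏ i ∈ (range n).erase s, ‖b - x ^ (i : ℤ)‖ :=
          prod_le_prod (fun i _ => by positivity) hfac
  exact mul_le_mul hδs hrest (by positivity) (norm_nonneg _)

end Bounds

/-! ### §3 The separating polynomials -/

section Separation

variable {x b : ℂ_[p]} {δ : ℝ}

/-- **SEPARATING POLYNOMIALS.** Let `x ∈ ℂ_p` with `‖x − 1‖ < p⁻¹` and `b ∈ ℂ_p` with
`‖b − x^n‖ ≥ δ > 0` for every `n : ℤ`. Then for every `ε > 0` there is a polynomial `G ∈ ℂ_p[X]` with
`‖G(x^k)‖ ≤ ε` and `‖G(b·x^k) − 1‖ ≤ ε` for ALL `k : ℕ`. Construction: `K` with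
`t₀ = ‖x − 1‖p^{−K}/δ < 1`, `P = ∏_{i<p^K}(X − x^i)`, `E0 = P(b) = ∏_{i<p^K}(b − x^i)`,
`e = P/E0`: `‖e(x^k)‖ ≤ t₀` (§2) and `‖e(b x^k) − 1‖ ≤ t₁ = max(‖x − 1‖, t₀)` (§1); then
`G = 1 − (1 − e^N)^N` with `t₁^N ≤ ε` (the bump, step II-a). [cite: Washington1997, §5.1] -/
theorem R1.exists_separating_polynomial (hx : ‖x - 1‖ < (p : ℝ)⁻¹) (hδ0 : 0 < δ)
    (hδ : ∀ n : ℤ, δ ≤ ‖b - x ^ n‖) {ε : ℝ} (hε : 0 < ε) :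
    ∃ G : ℂ_[p][X], (∀ k : ℕ, ‖G.eval (x ^ k)‖ ≤ ε) ∧ (∀ k : ℕ, ‖G.eval (b * x ^ k) - 1‖ ≤ ε) := by
  have hp : p.Prime := Fact.out
  have hp1' : (p : ℝ)⁻¹ < 1 := inv_lt_one_of_one_lt₀ (by exact_mod_cast hp.one_lt)
  have hx1 : ‖x - 1‖ < 1 := hx.trans hp1'
  have hx0 : x ≠ 0 := R1.ne_zero_of_norm_sub_one_lt hx1
  set ρ := ‖x - 1‖ with hρ
  have hρ0 : 0 ≤ ρ := norm_nonneg _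
  -- choose `K` with `t₀ = ρ p^{-K} / δ < 1`
  obtain ⟨K, hK⟩ : ∃ K : ℕ, ((p : ℝ)⁻¹) ^ K < δ / (ρ + 1) :=
    exists_pow_lt_of_lt_one (div_pos hδ0 (by linarith)) hp1'
  have hzpow : (p : ℝ) ^ (-(K : ℤ)) = ((p : ℝ)⁻¹) ^ K := by rw [zpow_neg, zpow_natCast, inv_pow]
  set t₀ := ρ * (p : ℝ) ^ (-(K : ℤ)) / δ with ht₀
  have ht₀0 : 0 ≤ t₀ := by positivity
  have ht₀1 : t₀ < 1 := by
    rw [ht₀, div_lt_one hδ0, hzpow]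
    have h1 : ρ * ((p : ℝ)⁻¹) ^ K ≤ (ρ + 1) * ((p : ℝ)⁻¹) ^ K :=
      mul_le_mul_of_nonneg_right (by linarith) (by positivity)
    have h2 : (ρ + 1) * ((p : ℝ)⁻¹) ^ K < (ρ + 1) * (δ / (ρ + 1)) :=
      mul_lt_mul_of_pos_left hK (by linarith)
    rw [mul_div_cancel₀ _ (by linarith : ρ + 1 ≠ 0)] at h2
    exact h1.trans_lt h2
  set t₁ := max ρ t₀ with ht₁
  have ht₁0 : 0 ≤ t₁ := le_max_of_le_left hρ0
  have ht₁1 : t₁ < 1 := max_lt hx1 ht₀1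
  -- `p^K = M + 1`
  obtain ⟨M, hM⟩ : ∃ M, p ^ K = M + 1 := ⟨p ^ K - 1, (Nat.succ_pred_eq_of_pos (pow_pos hp.pos K)).symm⟩
  -- the product polynomial and `E0`
  set P : ℂ_[p][X] := ∏ i ∈ range (p ^ K), (X - C (x ^ i)) with hP
  have hPeval : ∀ z : ℂ_[p], P.eval z = ∏ i ∈ range (p ^ K), (z - x ^ i) := fun z => by
    rw [hP, eval_prod]
    exact prod_congr rfl fun i _ => by rw [eval_sub, eval_X, eval_C]
  set E0 : ℂ_[p] := ∏ i ∈ range (p ^ K), (b - x ^ ((i : ℤ) - (0 : ℕ))) with hE0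
  have hE0' : E0 = ∏ i ∈ range (p ^ K), (b - x ^ i) :=
    prod_congr rfl fun i _ => by rw [Nat.cast_zero, sub_zero, zpow_natCast]
  have hE0ne : E0 ≠ 0 := by
    rw [hE0]; exact prod_ne_zero_iff.mpr fun i _ => norm_pos_iff.mp (hδ0.trans_le (hδ _))
  have hE0pos : 0 < ‖E0‖ := norm_pos_iff.mpr hE0ne
  -- lower bound for `‖E0‖`
  have hlow : δ * (ρ ^ (p ^ K - 1) * ‖(((p ^ K - 1).factorial : ℕ) : ℚ_[p])‖) ≤ ‖E0‖ :=
    R1.le_norm_sepProd_zero hx hδ (pow_pos hp.pos K)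
  -- S-side: `‖P(x^k)‖ ≤ t₀ ‖E0‖`
  have hS : ∀ k : ℕ, ‖P.eval (x ^ k) / E0‖ ≤ t₀ := by
    intro k
    rw [norm_div, div_le_iff₀ hE0pos, hPeval]
    have h1 := R1.norm_prod_pow_sub_pow_le hx (p ^ K) k
    have hfact : ‖(((p ^ K).factorial : ℕ) : ℚ_[p])‖ =
        (p : ℝ) ^ (-(K : ℤ)) * ‖(((p ^ K - 1).factorial : ℕ) : ℚ_[p])‖ := by
      rw [hM, Nat.add_sub_cancel, Nat.factorial_succ, Nat.cast_mul, norm_mul, ← hM, Nat.cast_pow,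
        norm_pow, Padic.norm_p, hzpow]
    have hρpow : ρ ^ (p ^ K) = ρ * ρ ^ (p ^ K - 1) := by
      rw [← pow_succ', hM, Nat.add_sub_cancel]
    calc ‖∏ i ∈ range (p ^ K), (x ^ k - x ^ i)‖
        ≤ ρ ^ (p ^ K) * ‖(((p ^ K).factorial : ℕ) : ℚ_[p])‖ := h1
      _ = ρ * (p : ℝ) ^ (-(K : ℤ)) * (ρ ^ (p ^ K - 1) * ‖(((p ^ K - 1).factorial : ℕ) : ℚ_[p])‖) := by
          rw [hfact, hρpow]; ring
      _ ≤ ρ * (p : ℝ) ^ (-(K : ℤ)) * (‖E0‖ / δ) := by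
          refine mul_le_mul_of_nonneg_left ?_ (by positivity)
          rw [le_div_iff₀ hδ0, mul_comm]
          exact hlow
      _ = t₀ * ‖E0‖ := by rw [ht₀]; ring
  -- B-side: `‖P(b x^k)/E0 − 1‖ ≤ t₁`
  have hB : ∀ k : ℕ, ‖P.eval (b * x ^ k) / E0 - 1‖ ≤ t₁ := by
    intro k
    rw [hPeval, R1.prod_mul_pow_sub_pow_eq hx0 b (p ^ K) k, mul_div_assoc]
    refine R1.norm_mul_sub_one_le ht₁1 ?_ ?_
    · exact (R1.norm_pow_sub_one_le hx1 _).trans (le_max_left _ _)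
    · exact (R1.norm_sepProd_div_sub_one_le hx hδ0 hδ ht₀1 k).trans (le_max_right _ _)
  -- the bump
  obtain ⟨N, hN⟩ : ∃ N : ℕ, t₁ ^ N < ε := exists_pow_lt_of_lt_one hε ht₁1
  refine ⟨1 - (1 - (C E0⁻¹ * P) ^ N) ^ N, fun k => ?_, fun k => ?_⟩
  · have he : ‖eval (x ^ k) (C E0⁻¹ * P)‖ ≤ t₁ := by
      rw [eval_mul, eval_C, mul_comm, ← div_eq_mul_inv]
      exact (hS k).trans (le_max_right _ _)
    have h := R1.norm_bump_le ht₁0 ht₁1 he N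
    simp only [eval_sub, eval_one, eval_pow] at h ⊢
    exact h.trans hN.le
  · have he : ‖eval (b * x ^ k) (C E0⁻¹ * P) - 1‖ ≤ t₁ := by
      rw [eval_mul, eval_C, mul_comm, ← div_eq_mul_inv]
      exact hB k
    have h := R1.norm_bump_sub_one_le ht₁1 he N
    simp only [eval_sub, eval_one, eval_pow] at h ⊢
    exact h.trans hN.le

end Separation

end Summit.BirchSwinnertonDyer.Rank1Residual.X11b

end
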